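import Summits.QuantumFields.YangMills.Theorems.ParabolicTrajectoryTunedSequenceExistsUnitsCore
import Summits.QuantumFields.YangMills.Theorems.ParabolicTrajectoryContinuumLimitOnTrajectoryDefsG
import Summits.QuantumFields.YangMills.Theorems.ParabolicTrajectoryContinuumLimitOnTrajectoryVolumeGlue

/-!
# Crux `TunedSequenceExists` (stmt-QuantumFields-10524): the line's glue RETHREADED to the repaired
# conjunct `TunedSequenceExistsPVG` of the unified rev-8 banner (lead c12, 2026-08-17)

The (A)-chain (crux `ContinuumLimitOnTrajectory`, stmt-QuantumFields-10522) certified (A) misstated as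
typed (torus-seam witness along slow-volume schemes) and typed the repair: (A_PVG) carries polynomial
volume growth `PolyVolumeGrowth sch` (`∃ N ≥ 1, ∀ᶠ k, a_k⁻¹ ≤ (a_k L_k)^N`) as an extra HYPOTHESIS, so
the constructor of tuned sequences — our crux (S) — must deliver it in its CONCLUSION:
`TwoOrbitSynchronisation.TunedSequenceExistsPVG` (`…ContinuumLimitOnTrajectoryDefsG`, (S) verbatim +
that one conjunct), with the rev-8 deciding theorems `closesPVG` /
`RegimeTrisection.yangMills_of_subs` / `TrisectionGap.yangMills_of_trisectionGap` all consuming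
(S_PVG) (banner item (b) `TunedSequenceExists ↦ TunedSequenceExistsPVG`, CROSS-CRUX notes of both
sibling chains).

The growth clause is NOT free from the crux core as this chain typed it: the finite-volume window
lower bound of `Negative.Glue.weak_iff_lowerBound` chooses the volume AFTER the depth
(`∀ L₀, ∃ m, ∃ L ≥ L₀ M^m`), so the scheme built by `Negative.Glue.weak_of_lowerBound` has
`a_k L_k ≥ k` only.  It IS free from every sufficient condition the line `fixed-aspect-window`
registered, because those bound the rescaled correlator from below on ALL large tori at the chosen
coupling:

* §1 `lowerBoundAllVolumes_of_femtoLower_of_volumeSlack` — (U_∃h) + (V_slack) ⇒ the ALL-VOLUME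
  window lower bound `∃ θ₀ > 0, ∃ L₁, ∀ B m₀, ∃ m ≥ m₀, ∃ β ≥ B, ∀ L ≥ L₁ M^m, θ₀ ≤ u(β, m, L)`
  (`u(β, m, L) := (M^m)⁸ ⟨P ; τ_{M^m} P⟩_{β, 2L+1}`, `P = r.curvature.F`);
  `lowerBoundAllVolumes_of_sharpLowerBound` — the units-form core (X) of `…UnitsCore` ⇒ the same,
  for an arbitrary observable; `core_of_lowerBoundAllVolumes` — it implies the window core;
* §2 `weakVol_of_lowerBoundAllVolumes` — exact tuning by the IVT (as `Negative.Glue.weak_of_lowerBound`)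
  with the volumes now PRESCRIBED, `M^(2 m_k) ≤ L_k` for every `k`;
* §3 `witnessVol_of_bounded` — diagonal extraction (as `FixedAspectSplit.witness_of_bounded`) carrying
  the volume clause along the subsequence;
* §4 `windowPVG_of_lowerBoundAllVolumes` — with (A) `CanonicalUpperBound`: the body of (S_PVG) at
  fixed `(G, r, M)`, the growth conjunct by `TwoOrbitSynchronisation.polyVolumeGrowth_of_shape`;
* §5 under the crux prefix, sorry-free:
  **`tunedSequenceExistsPVG_of_slack_mirror_subs : FemtoLowerBoundAll → VolumeMonotoneSlackAll →
  MirrorBoundInAll → MirrorBoundOutAll → TunedSequenceExistsPVG`** (the registered four stubs of the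
  line close the REPAIRED conjunct too — `--glue-by` declaration for a four-child split of (S_PVG)),
  `tunedSequenceExistsPVG_of_slack_subs` (three children with (A)),
  **`tunedSequenceExistsPVG_of_sharp_mirror_subs : SharpLowerBoundAll → MirrorBoundInAll →
  MirrorBoundOutAll → TunedSequenceExistsPVG`** (units option γ of crux NOTES §33, three children),
  `tunedSequenceExistsPVG_of_sharp_subs`; consistency with (S) as typed via
  `TwoOrbitSynchronisation.tunedSequenceExists_of_PVG`.

Nothing here is asserted: (U_∃h), (V_slack), (A_in), (A_out), (X) remain the open inputs (crux NOTES
§§16–37).  Obligation glue of the crux; not published facts.  Refs: `…SlackDefs` (p153967),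
`…UnitsCore` (p157021), `…ContinuumLimitOnTrajectoryDefsG`, `…VolumeGlue`; Osterwalder–Seiler 1978 §2.
-/

noncomputable section

open Filter Topology MeasureTheory
open Literature.MathematicalPhysics.QuantumFieldTheory Literature.MathematicalPhysics.QuantumLattice
open Summit.QuantumFields.YangMills.Cruxes.ContinuumLimitOnTrajectory.TwoOrbitSynchronisation
  (TunedSequenceExistsPVG PolyVolumeGrowth polyVolumeGrowth_of_shape tunedSequenceExists_of_PVG)

namespace Summit.QuantumFields.YangMills.Theorems.TunedSequenceExists.PVGGlue

/-! ## §1 All-volume window lower bounds from the line's sufficient conditions -/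

section AllVolumes

variable {G : Type} [Group G] [TopologicalSpace G] [IsTopologicalGroup G] [CompactSpace G]
  [MeasurableSpace G] [BorelSpace G]

/-- **(U_∃h) + (V_slack) ⇒ the ALL-VOLUME window lower bound** with `θ₀ = h / (2K)` and aspect floor
`L₁ = max LU LV`: as `FixedAspectSplit.lowerBound_of_femtoLower_of_volumeSlack`, except that the volume
comparison is kept for EVERY `L ≥ L₁ M^m` instead of being spent on one volume.  Pure quantifier
arithmetic. -/
theorem lowerBoundAllVolumes_of_femtoLower_of_volumeSlack (r : LatticeRep G) {M : ℕ}
    (hU : FixedAspectSplit.FemtoLowerBound r M) (hV : FixedAspectSplit.VolumeMonotoneSlack r M) :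
    ∃ θ₀ : ℝ, 0 < θ₀ ∧ ∃ L₁ : ℕ, ∀ (B : ℝ) (m₀ : ℕ), ∃ m : ℕ, m₀ ≤ m ∧ ∃ β : ℝ, B ≤ β ∧
      ∀ L : ℕ, L₁ * M ^ m ≤ L → θ₀ ≤ ((M : ℝ) ^ m) ^ 8 *
        latticeConnectedCorr r.ρ β (2 * L + 1) r.curvature.F r.curvature.F (M ^ m) := by
  obtain ⟨LU, hU⟩ := hU
  obtain ⟨K, hK, LV, hV⟩ := hV
  set L₁ : ℕ := max LU LV with hL₁
  obtain ⟨h, hh, hU'⟩ := hU L₁ (le_max_left _ _)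
  obtain ⟨β₁, m₁, hV'⟩ := hV L₁ (le_max_right _ _) (h / 2) (half_pos hh)
  refine ⟨h / (2 * K), by positivity, L₁, fun B m₀ => ?_⟩
  obtain ⟨m, hm, β, hβ, hu⟩ := hU' (max B β₁) (max m₀ m₁)
  refine ⟨m, (le_max_left _ _).trans hm, β, (le_max_left _ _).trans hβ, fun L hL => ?_⟩
  have hstep := hV' β m L ((le_max_right _ _).trans hβ) ((le_max_right _ _).trans hm) hL
  rw [div_le_iff₀ (by positivity : (0 : ℝ) < 2 * K)]
  nlinarith

/-- **(X) ⇒ the ALL-VOLUME window lower bound**, for an arbitrary observable `A` and every `M ≥ 2`, with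
`θ₀ = ε` and aspect floor `⌈Λ₅ / s₂⌉₊`: place `M^m · a(β)` exactly on the level `s₂` beyond the floors
(`UnitsCore.exists_depth_coupling_on_level`); every torus of aspect at least `⌈Λ₅ / s₂⌉₊` then has
physical half-size `≥ Λ₅`. -/
theorem lowerBoundAllVolumes_of_sharpLowerBound (r : LatticeRep G) (A : LGConfig 4 G → ℝ) {M : ℕ}
    (hM : 2 ≤ M) (h : UnitsCore.SharpLowerBound r A) :
    ∃ θ₀ : ℝ, 0 < θ₀ ∧ ∃ L₁ : ℕ, ∀ (B : ℝ) (m₀ : ℕ), ∃ m : ℕ, m₀ ≤ m ∧ ∃ β : ℝ, B ≤ β ∧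
      ∀ L : ℕ, L₁ * M ^ m ≤ L → θ₀ ≤ ((M : ℝ) ^ m) ^ 8 *
        latticeConnectedCorr r.ρ β (2 * L + 1) A A (M ^ m) := by
  obtain ⟨a, ha, hapos, hlim, s₁, s₂, ε, β₅, Λ₅, hs₁, hs₁₂, hε, h⟩ := h
  have hs₂ : 0 < s₂ := hs₁.trans_le hs₁₂
  refine ⟨ε, hε, ⌈Λ₅ / s₂⌉₊, fun B m₀ => ?_⟩
  obtain ⟨m, hm₀, β, hβ, hlevel⟩ :=
    UnitsCore.exists_depth_coupling_on_level ha hapos hlim hM hs₂ (max B β₅) m₀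
  refine ⟨m, hm₀, β, (le_max_left _ _).trans hβ, fun L hL => ?_⟩
  have hD : ((M ^ m : ℕ) : ℝ) * a β = s₂ := by push_cast; exact hlevel
  have hΛ : Λ₅ ≤ a β * (L : ℝ) := by
    have h1 : Λ₅ / s₂ ≤ ((⌈Λ₅ / s₂⌉₊ : ℕ) : ℝ) := Nat.le_ceil _
    have h2 : Λ₅ ≤ ((⌈Λ₅ / s₂⌉₊ : ℕ) : ℝ) * s₂ := by rwa [div_le_iff₀ hs₂] at h1
    have h3 : ((⌈Λ₅ / s₂⌉₊ * M ^ m : ℕ) : ℝ) ≤ (L : ℝ) := by exact_mod_cast hL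
    calc Λ₅ ≤ ((⌈Λ₅ / s₂⌉₊ : ℕ) : ℝ) * s₂ := h2
      _ = a β * ((⌈Λ₅ / s₂⌉₊ * M ^ m : ℕ) : ℝ) := by rw [← hD]; push_cast; ring
      _ ≤ a β * (L : ℝ) := mul_le_mul_of_nonneg_left h3 (hapos β).le
  have hstep := h β ((le_max_right _ _).trans hβ) L (M ^ m) hΛ (by rw [hD]; exact hs₁₂) hD.le
  simpa only [Nat.cast_pow] using hstep

/-- The all-volume window lower bound implies the window core of `Negative.Glue.weak_iff_lowerBound`
(take `L = max L₀ L₁ · M^m`); so it is at least the core, and it is what every registered sufficient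
condition of the line actually proves. -/
theorem core_of_lowerBoundAllVolumes (r : LatticeRep G) (A : LGConfig 4 G → ℝ) {M : ℕ}
    (h : ∃ θ₀ : ℝ, 0 < θ₀ ∧ ∃ L₁ : ℕ, ∀ (B : ℝ) (m₀ : ℕ), ∃ m : ℕ, m₀ ≤ m ∧ ∃ β : ℝ, B ≤ β ∧
      ∀ L : ℕ, L₁ * M ^ m ≤ L → θ₀ ≤ ((M : ℝ) ^ m) ^ 8 *
        latticeConnectedCorr r.ρ β (2 * L + 1) A A (M ^ m)) :
    ∃ θ₀ : ℝ, 0 < θ₀ ∧ ∀ (B : ℝ) (m₀ L₀ : ℕ), ∃ m : ℕ, m₀ ≤ m ∧ ∃ L : ℕ, L₀ * M ^ m ≤ L ∧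
      ∃ β : ℝ, B ≤ β ∧ θ₀ ≤ ((M : ℝ) ^ m) ^ 8 *
        latticeConnectedCorr r.ρ β (2 * L + 1) A A (M ^ m) := by
  obtain ⟨θ₀, hθ₀, L₁, h⟩ := h
  refine ⟨θ₀, hθ₀, fun B m₀ L₀ => ?_⟩
  obtain ⟨m, hm, β, hβ, hall⟩ := h B m₀
  exact ⟨m, hm, max L₀ L₁ * M ^ m, Nat.mul_le_mul_right _ (le_max_left _ _), β, hβ,
    hall _ (Nat.mul_le_mul_right _ (le_max_right _ _))⟩

end AllVolumes

/-! ## §2 Exact tuning by the IVT with PRESCRIBED volumes `M^(2 m_k) ≤ L_k` -/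

section Tuning

variable {G : Type} [Group G] [TopologicalSpace G] [IsTopologicalGroup G] [CompactSpace G]
  [MeasurableSpace G] [BorelSpace G]

/-- **All-volume lower bound ⇒ weak crux body with EXACT tuning and prescribed volumes.**  As
`Negative.Glue.weak_of_lowerBound` (β-continuity, freezing, intermediate value theorem at a fixed
lattice), but at stage `k` the torus half-side is CHOSEN as
`L_k = max (max L₁ k · M^{m_k}) (M^{2 m_k})` — admissible because the lower bound holds on every torus
`L ≥ L₁ M^{m_k}` at the same coupling — so that `a_k L_k ≥ k` (a scheme) and `M^(2 m_k) ≤ L_k` (the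
`M`-adic rendering of polynomial volume growth). -/
theorem weakVol_of_lowerBoundAllVolumes (r : LatticeRep G) {M : ℕ} (hM : 2 ≤ M)
    (h : ∃ θ₀ : ℝ, 0 < θ₀ ∧ ∃ L₁ : ℕ, ∀ (B : ℝ) (m₀ : ℕ), ∃ m : ℕ, m₀ ≤ m ∧ ∃ β : ℝ, B ≤ β ∧
      ∀ L : ℕ, L₁ * M ^ m ≤ L → θ₀ ≤ ((M : ℝ) ^ m) ^ 8 *
        latticeConnectedCorr r.ρ β (2 * L + 1) r.curvature.F r.curvature.F (M ^ m)) :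
    ∃ θ₀ : ℝ, 0 < θ₀ ∧ ∀ θ : ℝ, 0 < θ → θ < θ₀ →
      ∃ (sch : SpeciesScheme (YMSpecies G)) (n : ℕ → ℕ),
        (∀ k, sch.a k = ((M : ℝ) ^ n k)⁻¹) ∧ Tendsto sch.β atTop atTop ∧
        (∀ k, M ^ (2 * n k) ≤ sch.L k) ∧
        Tendsto (fun k => ((M : ℝ) ^ n k) ^ 8 *
            latticeConnectedCorr r.ρ (sch.β k) (sch.side k) r.curvature.F r.curvature.F
              (M ^ n k)) atTop (𝓝 θ) := by
  obtain ⟨θ₀, hθ₀, L₁, h⟩ := h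
  refine ⟨θ₀, hθ₀, fun θ hθ hθθ₀ => ?_⟩
  choose m hm βs hβs hcorr using fun k : ℕ => h (k : ℝ) k
  -- the prescribed volumes
  set L : ℕ → ℕ := fun k => max (max L₁ k * M ^ m k) (M ^ (2 * m k)) with hLdef
  have hL₁ : ∀ k, L₁ * M ^ m k ≤ L k := fun k =>
    (Nat.mul_le_mul_right _ (le_max_left _ _)).trans (le_max_left _ _)
  have hLk : ∀ k, k * M ^ m k ≤ L k := fun k =>
    (Nat.mul_le_mul_right _ (le_max_right _ _)).trans (le_max_left _ _)
  have hLsq : ∀ k, M ^ (2 * m k) ≤ L k := fun k => le_max_right _ _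
  choose β hββs hβeq using fun k : ℕ =>
    Negative.Glue.exists_ge_corr_eq r M (m k) (L k) hθ hθθ₀ (hcorr k (L k) (hL₁ k))
  have hM1 : (1 : ℝ) < M := by exact_mod_cast hM
  have hm_top : Tendsto m atTop atTop := tendsto_atTop_mono hm tendsto_id
  have hpow_top : Tendsto (fun k => (M : ℝ) ^ m k) atTop atTop :=
    (tendsto_pow_atTop_atTop_of_one_lt hM1).comp hm_top
  let sch : SpeciesScheme (YMSpecies G) :=
    { a := fun k => ((M : ℝ) ^ m k)⁻¹
      a_pos := fun k => by positivity
      tendsto_a := tendsto_inv_atTop_zero.comp hpow_top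
      β := β
      L := L
      tendsto_L := by
        refine tendsto_atTop_mono (fun k => ?_) tendsto_natCast_atTop_atTop
        have hLk' : (k : ℝ) * (M : ℝ) ^ m k ≤ L k := by exact_mod_cast hLk k
        have hp : (0 : ℝ) < (M : ℝ) ^ m k := by positivity
        show (k : ℝ) ≤ ((M : ℝ) ^ m k)⁻¹ * (L k : ℝ)
        rw [inv_mul_eq_div, le_div_iff₀ hp]
        exact hLk'
      c := fun _ _ => 0
      m := fun _ _ => 0 }
  refine ⟨sch, m, fun k => rfl, ?_, hLsq, ?_⟩
  · exact tendsto_atTop_mono (fun k => (hβs k).trans (hββs k)) tendsto_natCast_atTop_atTop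
  · exact tendsto_const_nhds.congr fun k => (hβeq k).symm

end Tuning

/-! ## §3 Diagonal extraction carrying the volume clause -/

section Extraction

variable {G : Type} [Group G] [TopologicalSpace G] [IsTopologicalGroup G] [CompactSpace G]
  [MeasurableSpace G] [BorelSpace G]

/-- **Diagonal extraction with the volume clause**: as `FixedAspectSplit.witness_of_bounded` (a tuned
`M`-adic witness with `β_k → ∞` along which every `N_t` is bounded has a re-indexing along which every
`N_t` converges), the clause `M^(2 n_k) ≤ L_k` passing to the subsequence. -/
theorem witnessVol_of_bounded (r : LatticeRep G) (M : ℕ) (θ : ℝ) (sch : SpeciesScheme (YMSpecies G))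
    (n : ℕ → ℕ) (hshape : ∀ k, sch.a k = ((M : ℝ) ^ n k)⁻¹) (hβ : Tendsto sch.β atTop atTop)
    (hvol : ∀ k, M ^ (2 * n k) ≤ sch.L k)
    (hbdd : ∀ t : ℕ, 0 < t → ∃ C : ℝ, ∀ k, |((M : ℝ) ^ n k) ^ 8 *
        latticeConnectedCorr r.ρ (sch.β k) (sch.side k) r.curvature.F r.curvature.F
          (t * M ^ n k)| ≤ C)
    (hlim : Tendsto (fun k => ((M : ℝ) ^ n k) ^ 8 *
        latticeConnectedCorr r.ρ (sch.β k) (sch.side k) r.curvature.F r.curvature.F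
          (M ^ n k)) atTop (𝓝 θ)) :
    ∃ (sch' : SpeciesScheme (YMSpecies G)) (n' : ℕ → ℕ),
      (∀ k, sch'.a k = ((M : ℝ) ^ n' k)⁻¹) ∧ Tendsto sch'.β atTop atTop ∧
      (∀ t : ℕ, 0 < t → ∃ c : ℝ, Tendsto (fun k => ((M : ℝ) ^ n' k) ^ 8 *
          latticeConnectedCorr r.ρ (sch'.β k) (sch'.side k) r.curvature.F r.curvature.F
            (t * M ^ n' k)) atTop (𝓝 c)) ∧
      Tendsto (fun k => ((M : ℝ) ^ n' k) ^ 8 *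
          latticeConnectedCorr r.ρ (sch'.β k) (sch'.side k) r.curvature.F r.curvature.F
            (M ^ n' k)) atTop (𝓝 θ) ∧
      (∀ k, M ^ (2 * n' k) ≤ sch'.L k) := by
  set u : ℕ → ℕ → ℝ := fun k t' => ((M : ℝ) ^ n k) ^ 8 *
    latticeConnectedCorr r.ρ (sch.β k) (sch.side k) r.curvature.F r.curvature.F
      ((t' + 1) * M ^ n k) with hu
  choose C hC using fun t' : ℕ => hbdd (t' + 1) (Nat.succ_pos t')
  set K : Set (ℕ → ℝ) := Set.pi Set.univ fun t' => Set.Icc (-C t') (C t') with hK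
  have hKc : IsCompact K := isCompact_univ_pi fun t' => isCompact_Icc
  have huK : ∀ k, u k ∈ K := fun k => by
    simp only [hK, Set.mem_pi, Set.mem_univ, true_implies, Set.mem_Icc]
    intro t'
    exact abs_le.1 (hC t' k)
  obtain ⟨lim, -, φ, hφ, hconv⟩ := hKc.tendsto_subseq huK
  refine ⟨FixedAspectSplit.reindex sch φ hφ, n ∘ φ, fun k => hshape (φ k),
    hβ.comp hφ.tendsto_atTop, ?_, hlim.comp hφ.tendsto_atTop, fun k => hvol (φ k)⟩
  intro t ht
  obtain ⟨t', rfl⟩ := Nat.exists_eq_succ_of_ne_zero ht.ne'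
  refine ⟨lim t', ?_⟩
  have h1 : Tendsto (fun j => u (φ j) t') atTop (𝓝 (lim t')) := tendsto_pi_nhds.1 hconv t'
  refine h1.congr fun j => ?_
  simp only [hu, Function.comp_apply, FixedAspectSplit.reindex_β, FixedAspectSplit.reindex_side,
    Nat.succ_eq_add_one]

end Extraction

/-! ## §4 The body of (S_PVG) at fixed data from the all-volume lower bound and (A) -/

section Window

variable {G : Type} [Group G] [TopologicalSpace G] [IsTopologicalGroup G] [CompactSpace G]
  [MeasurableSpace G] [BorelSpace G]

/-- **The body of `TunedSequenceExistsPVG` at fixed `(G, r, M)`, `M ≥ 2`, from the all-volume window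
lower bound and (A)**: exact tuning with prescribed volumes (`weakVol_of_lowerBoundAllVolumes`) ⇒
a-priori bound from (A) (`FixedAspectSplit.bounded_of_canonicalUpperBound`) ⇒ diagonal extraction with
the volume clause (`witnessVol_of_bounded`) ⇒ polynomial volume growth from `M^(2 n_k) ≤ L_k`
(`TwoOrbitSynchronisation.polyVolumeGrowth_of_shape`, `N = 1`). -/
theorem windowPVG_of_lowerBoundAllVolumes (r : LatticeRep G) {M : ℕ} (hM : 2 ≤ M)
    (h : ∃ θ₀ : ℝ, 0 < θ₀ ∧ ∃ L₁ : ℕ, ∀ (B : ℝ) (m₀ : ℕ), ∃ m : ℕ, m₀ ≤ m ∧ ∃ β : ℝ, B ≤ β ∧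
      ∀ L : ℕ, L₁ * M ^ m ≤ L → θ₀ ≤ ((M : ℝ) ^ m) ^ 8 *
        latticeConnectedCorr r.ρ β (2 * L + 1) r.curvature.F r.curvature.F (M ^ m))
    (hA : FixedAspectSplit.CanonicalUpperBound r) :
    ∃ θ₀ : ℝ, 0 < θ₀ ∧ ∀ θ : ℝ, 0 < θ → θ < θ₀ →
      ∃ (sch : SpeciesScheme (YMSpecies G)) (n : ℕ → ℕ),
        (∀ k, sch.a k = ((M : ℝ) ^ n k)⁻¹) ∧ Tendsto sch.β atTop atTop ∧
        (∀ t : ℕ, 0 < t → ∃ c : ℝ, Tendsto (fun k => ((M : ℝ) ^ n k) ^ 8 *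
            latticeConnectedCorr r.ρ (sch.β k) (sch.side k) r.curvature.F r.curvature.F
              (t * M ^ n k)) atTop (𝓝 c)) ∧
        Tendsto (fun k => ((M : ℝ) ^ n k) ^ 8 *
            latticeConnectedCorr r.ρ (sch.β k) (sch.side k) r.curvature.F r.curvature.F
              (M ^ n k)) atTop (𝓝 θ) ∧
        (∃ N : ℕ, 1 ≤ N ∧ ∀ᶠ k in atTop, (sch.a k)⁻¹ ≤ (sch.a k * (sch.L k : ℝ)) ^ N) := by
  obtain ⟨θ₀, hθ₀, hweak⟩ := weakVol_of_lowerBoundAllVolumes r hM h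
  refine ⟨θ₀, hθ₀, fun θ hθ hθ' => ?_⟩
  obtain ⟨sch, n, hshape, hβ, hvol, hlim⟩ := hweak θ hθ hθ'
  obtain ⟨sch', n', hshape', hβ', hconv', hlim', hvol'⟩ := witnessVol_of_bounded r M θ sch n hshape
    hβ hvol (fun t ht => FixedAspectSplit.bounded_of_canonicalUpperBound r hA sch n hshape hβ t ht) hlim
  have hgrowth : PolyVolumeGrowth sch' :=
    polyVolumeGrowth_of_shape sch' hshape' (Eventually.of_forall hvol')
  exact ⟨sch', n', hshape', hβ', hconv', hlim', hgrowth⟩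

end Window

/-! ## §5 Under the crux prefix: the line's children close the REPAIRED conjunct (S_PVG) -/

/-- **Three-child glue for (S_PVG)**: `FemtoLowerBoundAll → VolumeMonotoneSlackAll →
CanonicalUpperBoundAll → TunedSequenceExistsPVG` (sorry-free). -/
theorem tunedSequenceExistsPVG_of_slack_subs (hU : FixedAspectSplit.FemtoLowerBoundAll)
    (hV : FixedAspectSplit.VolumeMonotoneSlackAll) (hA : FixedAspectSplit.CanonicalUpperBoundAll) :
    TunedSequenceExistsPVG := by
  intro G _ _ _ _ hG
  letI : MeasurableSpace G := borel G
  haveI : BorelSpace G := ⟨rfl⟩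
  intro r M hM
  exact windowPVG_of_lowerBoundAllVolumes r hM
    (lowerBoundAllVolumes_of_femtoLower_of_volumeSlack r (hU G hG r M hM) (hV G hG r M hM)) (hA G hG r)

/-- **Four-child glue for (S_PVG) on the REGISTERED stubs of the line `fixed-aspect-window`**:
`FemtoLowerBoundAll → VolumeMonotoneSlackAll → MirrorBoundInAll → MirrorBoundOutAll →
TunedSequenceExistsPVG` — (A_in) + (A_out) ⇒ (A) by odd-torus reflection positivity + Cauchy–Schwarz
(`MirrorBound.canonicalUpperBoundAll_of_mirror`), then the three-child glue.  The `--glue-by`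
declaration of a four-child route-level split of the repaired conjunct (header on one line, verbatim the
sub-goal registered on the item). [cite: OsterwalderSeiler1978, §2] -/
theorem tunedSequenceExistsPVG_of_slack_mirror_subs : Summit.QuantumFields.YangMills.Theorems.TunedSequenceExists.FixedAspectSplit.FemtoLowerBoundAll → Summit.QuantumFields.YangMills.Theorems.TunedSequenceExists.FixedAspectSplit.VolumeMonotoneSlackAll → Summit.QuantumFields.YangMills.Theorems.TunedSequenceExists.FixedAspectSplit.MirrorBoundInAll → Summit.QuantumFields.YangMills.Theorems.TunedSequenceExists.FixedAspectSplit.MirrorBoundOutAll → Summit.QuantumFields.YangMills.Cruxes.ContinuumLimitOnTrajectory.TwoOrbitSynchronisation.TunedSequenceExistsPVG :=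
  fun hU hV hIn hOut =>
    tunedSequenceExistsPVG_of_slack_subs hU hV (MirrorBound.canonicalUpperBoundAll_of_mirror hIn hOut)

/-- **Two-child glue for (S_PVG), units form**: `SharpLowerBoundAll → CanonicalUpperBoundAll →
TunedSequenceExistsPVG` (sorry-free). -/
theorem tunedSequenceExistsPVG_of_sharp_subs (hX : UnitsCore.SharpLowerBoundAll)
    (hA : FixedAspectSplit.CanonicalUpperBoundAll) : TunedSequenceExistsPVG := by
  intro G _ _ _ _ hG
  letI : MeasurableSpace G := borel G
  haveI : BorelSpace G := ⟨rfl⟩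
  intro r M hM
  exact windowPVG_of_lowerBoundAllVolumes r hM
    (lowerBoundAllVolumes_of_sharpLowerBound r r.curvature.F hM (hX G hG r)) (hA G hG r)

/-- **Three-child glue for (S_PVG), units form** (option γ of the crux notes for the REPAIRED conjunct):
`SharpLowerBoundAll → MirrorBoundInAll → MirrorBoundOutAll → TunedSequenceExistsPVG` (header on one line,
verbatim the sub-goal registered on the item). [cite: OsterwalderSeiler1978, §2] -/
theorem tunedSequenceExistsPVG_of_sharp_mirror_subs : Summit.QuantumFields.YangMills.Theorems.TunedSequenceExists.UnitsCore.SharpLowerBoundAll → Summit.QuantumFields.YangMills.Theorems.TunedSequenceExists.FixedAspectSplit.MirrorBoundInAll → Summit.QuantumFields.YangMills.Theorems.TunedSequenceExists.FixedAspectSplit.MirrorBoundOutAll → Summit.QuantumFields.YangMills.Cruxes.ContinuumLimitOnTrajectory.TwoOrbitSynchronisation.TunedSequenceExistsPVG :=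
  fun hX hIn hOut =>
    tunedSequenceExistsPVG_of_sharp_subs hX (MirrorBound.canonicalUpperBoundAll_of_mirror hIn hOut)

/-- Consistency with (S) as typed: the four registered stubs still close the crux BY NAME through the
repaired conjunct (`TwoOrbitSynchronisation.tunedSequenceExists_of_PVG` drops the growth clause). -/
example (hU : FixedAspectSplit.FemtoLowerBoundAll) (hV : FixedAspectSplit.VolumeMonotoneSlackAll)
    (hIn : FixedAspectSplit.MirrorBoundInAll) (hOut : FixedAspectSplit.MirrorBoundOutAll) :
    Summit.QuantumFields.YangMills.Theses.ParabolicTrajectory.TunedSequenceExists :=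
  tunedSequenceExists_of_PVG (tunedSequenceExistsPVG_of_slack_mirror_subs hU hV hIn hOut)

/-- Consistency, units form: X_P with the two mirror children closes the crux by name through (S_PVG). -/
example (hX : UnitsCore.SharpLowerBoundAll) (hIn : FixedAspectSplit.MirrorBoundInAll)
    (hOut : FixedAspectSplit.MirrorBoundOutAll) :
    Summit.QuantumFields.YangMills.Theses.ParabolicTrajectory.TunedSequenceExists :=
  tunedSequenceExists_of_PVG (tunedSequenceExistsPVG_of_sharp_mirror_subs hX hIn hOut)

end Summit.QuantumFields.YangMills.Theorems.TunedSequenceExists.PVGGlue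

end
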